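import Summits.QuantumFields.BalabanUV.T4Continuum.Support.AveragingDeficitNearIdentity
import Literature.MathematicalPhysics.QuantumFieldTheory.Balaban1983to89.BlockAveragingFederbush
import HarnessLib

/-!
# T⁴ programme, node NE3 — kinematic refinement lemma, row R0 (glue), part 1: THE GENERIC PERTURBATION TOOLKIT
# (small-field radius, flux and covariant flux gradient of a lattice gauge field under a bond-wise near-identity
# modification)

NE3 formalisation swarm `b2b-balaban-t4-ne3-formalise-*`, LEAF PROVER 09 (unit `b2b-balaban-t4-ne3-formalise-leaf-09`),
crew register `t4/formal/NE3/LEAVES.md` row **R0** of the cell `pub-balaban`; owner skeleton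
`t4/b2b-balaban-t4-ne3-p1/SKELETON-NE3-P1.md` v1.1 §3 row R0 («GLUE `SmoothRefine (sfClass d L N ε) L N b c b′ c′` ⇐
R1 ∧ R2: `b′ = b₁ + 2K m L³`, `c′ = c₁ + K′ m L³`»).

## Why this file exists

The kinematic lemma `MinimalActionRefine.SmoothRefine` (the re-cut of the action sandwich's refinement hypothesis (H2))
is assembled from R1 (an APPROXIMATELY averaging smooth fine field `W`, mismatch `m`) and R2 (an EXACT correction of `W`
on the chain-end bonds by unitaries `c` with `‖c − 1‖ ≤ K·m`).  The output clause of `SmoothRefine` is sup-form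
regularity of the CORRECTED field: its small-field radius AND its pointwise covariant flux gradient.  The transport of
these two data through a bond-wise near-identity modification `‖W′(b) − W(b)‖ ≤ ρ` is generic lattice-gauge
bookkeeping, independent of how `W` and `c` are built; it is proved here once, with absolute numerical constants:

* §1 (any complete normed ring with `‖1‖ = 1`, `U1`-valued configurations): the transport (9) `hol` is `1`-Lipschitz in
  every bond variable it visits — `‖W′(Γ) − W(Γ)‖ ≤ |Γ|·ρ` (`norm_hol_sub_hol_le`, hypothesis only on `bondsOf x Γ`);
* §2 (unitary matrices, operator norm (19)): plaquette variables move by `≤ 4ρ` (`norm_fhol_sub_fhol_le`), so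
  `SmallField W a → SmallField W′ (a + 4ρ)` (`smallField_perturb`);
* §3 the flux `F = log W(∂p)` moves by `≤ 8ρ` once `a + 4ρ ≤ 1/2` (`norm_flux_sub_flux_le`; the tree's Lipschitz bound
  `FederbushMean.norm_mlog_sub_mlog_le` for the series (21));
* §4 the covariant flux gradient `(∇_W F)(x, κ; π) = Ad_{W(x,κ)}F(x + e_κ; π) − F(x; π)` moves by `≤ (16 + 4a)ρ ≤ 18ρ`
  (`norm_covGrad_flux_sub_le`), so a pointwise bound `g` becomes `g + 18ρ` (`covGrad_flux_perturb`);
* §5 right multiplication `W·u` by unitaries: unitarity, periodicity, and `‖W u − W‖ ≤ ‖u − 1‖`;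
* §6 the LEVEL reading used by R0: data `(b₁·(L^{j+1})^{−2}, c₁·(L^{j+1})^{−3})` and `ρ ≤ m·(L^j)^{−3}` give
  `((b₁ + 4mL³)·(L^{j+1})^{−2}, (c₁ + 18mL³)·(L^{j+1})^{−3})` — the constants `2K`, `K′` of §3 R0 made explicit
  (`smallField_level_perturb`, `covGrad_flux_level_perturb`).

Gauge invariance of the same data (the crew may build `W` in any block-axial gauge) is ALREADY in the tree and is not
restated: `AveragingDeficitDerivWallProof.flux_gaugeAct`, `….covGrad_flux_gaugeAct`, `B7Prop1Explicit.hol_gaugeAct_closed`.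

HONEST FRAMING.  Elementary normed-algebra bookkeeping about Wilson plaquettes and the series logarithm; [folklore].
Nothing here is a statement of Bałaban's papers and no printed sentence is a hypothesis; no `def … : Prop` fact; no
`sorry`; axioms ⊆ {propext, Classical.choice, Quot.sound}.  NE3 is NOT proved by this file (it serves the glue R0 of
the unproved kinematic lemma `SmoothRefine`, itself hypothesis (H2) of reading (A)); the cell's conditionals
(`BetaPertH`, (B), G-an2-4) occur nowhere here; finite T⁴ rung (B)+1 — NOT infinite volume, NOT a mass gap, NOT the
Clay problem.  HONEST DEPENDENCY (cell page 1): continuum YM on T⁴ ⇐ BetaPertH ∧ nine spine estimates (0/9 proved);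
BetaPertH ⇐ (D1) ∧ (D4) ∧ CAP+tail; G-an2-4 gates asym, D1 and NE2/3/4.  PLACEMENT (human rule 2026-08-19): cell work
under `Summits/QuantumFields/BalabanUV/`; imports tree modules only (`Support.AveragingDeficitNearIdentity` for the
`Ad`/unitary tools and `bondsOf`, `BlockAveragingFederbush` for the Lipschitz bound of `mlog`); moves nothing.
-/

set_option autoImplicit false

open scoped BigOperators Matrix Matrix.Norms.L2Operator
open NormedSpace Finset

namespace Summit.QuantumFields.BalabanUV.T4Continuum.GaugeFieldPerturbation

open Literature.MathematicalPhysics.QuantumFieldTheory.Balaban1983to89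
open B7Prop1Explicit B7Prop2Explicit MatrixLog UnitaryModel
open T4AveragingDeficitWall hiding Site Plane Plaq Bond
open T4AveragingDeficitWallBoundary (IsPeriodicCfg)
open T4AveragingDeficitNonAbelian (Ad_mul Ad_sub)
open AveragingDeficitTransport AveragingDeficitLocality AveragingDeficitNearIdentity
open FederbushMean (norm_mlog_sub_mlog_le)

noncomputable section

/-! ## §1 The transport (9) is `1`-Lipschitz in each bond variable it visits -/

section Words

variable {d : ℕ} {𝔸 : Type*} [NormedRing 𝔸] [NormOneClass 𝔸]

/-- `‖a⁻¹ − b⁻¹‖ ≤ ‖a − b‖` for units of norm `≤ 1` with inverses of norm `≤ 1` (`a⁻¹ − b⁻¹ = a⁻¹(b − a)b⁻¹`).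
[folklore] -/
theorem norm_units_inv_sub_inv_le {a b : 𝔸ˣ} (ha : a ∈ U1 𝔸) (hb : b ∈ U1 𝔸) :
    ‖((a⁻¹ : 𝔸ˣ) : 𝔸) - ((b⁻¹ : 𝔸ˣ) : 𝔸)‖ ≤ ‖(a : 𝔸) - (b : 𝔸)‖ := by
  have e1 : ((a⁻¹ : 𝔸ˣ) : 𝔸) - ((b⁻¹ : 𝔸ˣ) : 𝔸) = ((a⁻¹ : 𝔸ˣ) : 𝔸) * ((b : 𝔸) - (a : 𝔸)) * ((b⁻¹ : 𝔸ˣ) : 𝔸) := by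
    rw [mul_sub, sub_mul, Units.inv_mul, one_mul, mul_assoc, Units.mul_inv, mul_one]
  rw [e1]
  calc _ ≤ ‖((a⁻¹ : 𝔸ˣ) : 𝔸)‖ * ‖(b : 𝔸) - (a : 𝔸)‖ * ‖((b⁻¹ : 𝔸ˣ) : 𝔸)‖ :=
        (norm_mul_le _ _).trans (mul_le_mul_of_nonneg_right (norm_mul_le _ _) (norm_nonneg _))
    _ ≤ 1 * ‖(b : 𝔸) - (a : 𝔸)‖ * 1 := by
        gcongr
        · exact (mem_U1.mp ha).2
        · exact (mem_U1.mp hb).2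
    _ = ‖(a : 𝔸) - (b : 𝔸)‖ := by rw [one_mul, mul_one, norm_sub_rev]

omit [NormOneClass 𝔸] in
/-- `‖ab − a′b′‖ ≤ ‖a − a′‖ + ‖b − b′‖` when `‖b‖ ≤ 1` and `‖a′‖ ≤ 1` (`ab − a′b′ = (a − a′)b + a′(b − b′)`). [folklore] -/
theorem norm_mul_sub_mul_le_of_norm_le_one {a b a' b' : 𝔸} (hb : ‖b‖ ≤ 1) (ha' : ‖a'‖ ≤ 1) :
    ‖a * b - a' * b'‖ ≤ ‖a - a'‖ + ‖b - b'‖ := by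
  have e1 : a * b - a' * b' = (a - a') * b + a' * (b - b') := by noncomm_ring
  rw [e1]
  calc _ ≤ ‖(a - a') * b‖ + ‖a' * (b - b')‖ := norm_add_le _ _
    _ ≤ ‖a - a'‖ * ‖b‖ + ‖a'‖ * ‖b - b'‖ := add_le_add (norm_mul_le _ _) (norm_mul_le _ _)
    _ ≤ ‖a - a'‖ * 1 + 1 * ‖b - b'‖ := by gcongr
    _ = ‖a - a'‖ + ‖b - b'‖ := by rw [mul_one, one_mul]

/-- One letter: `‖W′(b_l) − W(b_l)‖` controls the step transport of `l` from `x` (for the backward letter through the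
inverse, `norm_units_inv_sub_inv_le`); `b_l` is the bond recorded by `bondsOf`. [folklore] -/
theorem norm_stepHol_sub_stepHol_le {W W' : Site d → Fin d → 𝔸ˣ} (hW : ∀ x κ, W x κ ∈ U1 𝔸)
    (hW' : ∀ x κ, W' x κ ∈ U1 𝔸) (x : Site d) (l : Letter d) :
    ‖((stepHol W' x l : 𝔸ˣ) : 𝔸) - ((stepHol W x l : 𝔸ˣ) : 𝔸)‖
      ≤ ‖((W' (if l.2 then x else x + l.vec) l.1 : 𝔸ˣ) : 𝔸) - ((W (if l.2 then x else x + l.vec) l.1 : 𝔸ˣ) : 𝔸)‖ := by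
  obtain ⟨μ, b⟩ := l
  cases b
  · simp only [stepHol, Bool.false_eq_true, ↓reduceIte]
    exact norm_units_inv_sub_inv_le (hW' _ _) (hW _ _)
  · simp [stepHol]

/-- **The transport (9) is `1`-Lipschitz in every bond variable it visits**: if `‖W′(b) − W(b)‖ ≤ ρ` on the bonds of
the word `Γ` spelled from `x`, then `‖W′(Γ) − W(Γ)‖ ≤ |Γ|·ρ` (`U1`-valued configurations: every partial transport has
norm `≤ 1`). [folklore] -/
theorem norm_hol_sub_hol_le {W W' : Site d → Fin d → 𝔸ˣ} (hW : ∀ x κ, W x κ ∈ U1 𝔸) (hW' : ∀ x κ, W' x κ ∈ U1 𝔸)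
    {ρ : ℝ} : ∀ (x : Site d) (w : List (Letter d)),
      (∀ b ∈ bondsOf x w, ‖((W' b.1 b.2 : 𝔸ˣ) : 𝔸) - ((W b.1 b.2 : 𝔸ˣ) : 𝔸)‖ ≤ ρ) →
      ‖((hol W' x w : 𝔸ˣ) : 𝔸) - ((hol W x w : 𝔸ˣ) : 𝔸)‖ ≤ w.length * ρ
  | x, [], _ => by simp
  | x, l :: w, h => by
    rw [hol_cons, hol_cons, Units.val_mul, Units.val_mul, List.length_cons, Nat.cast_succ, add_mul, one_mul]
    have ih := norm_hol_sub_hol_le hW hW' (x + l.vec) w fun b hb =>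
      h b (by rw [bondsOf_cons]; exact List.mem_cons_of_mem _ hb)
    have hl : ‖((stepHol W' x l : 𝔸ˣ) : 𝔸) - ((stepHol W x l : 𝔸ˣ) : 𝔸)‖ ≤ ρ := by
      refine (norm_stepHol_sub_stepHol_le hW hW' x l).trans ?_
      have hmem : (if l.2 then (x, l.1) else (x + l.vec, l.1)) ∈ bondsOf x (l :: w) := by
        rw [bondsOf_cons]; exact List.mem_cons_self
      have := h _ hmem
      obtain ⟨μ, b⟩ := l
      cases b <;> simpa using this
    calc _ ≤ ‖((stepHol W' x l : 𝔸ˣ) : 𝔸) - ((stepHol W x l : 𝔸ˣ) : 𝔸)‖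
          + ‖((hol W' (x + l.vec) w : 𝔸ˣ) : 𝔸) - ((hol W (x + l.vec) w : 𝔸ˣ) : 𝔸)‖ :=
          norm_mul_sub_mul_le_of_norm_le_one (mem_U1.mp (hol_mem hW' _ _)).1 (mem_U1.mp (stepHol_mem hW _ _)).1
      _ ≤ ρ + w.length * ρ := add_le_add hl ih
      _ = w.length * ρ + ρ := add_comm _ _

/-- Global form: a uniform bond-wise bound `ρ` gives `‖W′(Γ) − W(Γ)‖ ≤ |Γ|·ρ` for every word. [folklore] -/
theorem norm_hol_sub_hol_le_of_forall {W W' : Site d → Fin d → 𝔸ˣ} (hW : ∀ x κ, W x κ ∈ U1 𝔸)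
    (hW' : ∀ x κ, W' x κ ∈ U1 𝔸) {ρ : ℝ} (h : ∀ x κ, ‖((W' x κ : 𝔸ˣ) : 𝔸) - ((W x κ : 𝔸ˣ) : 𝔸)‖ ≤ ρ)
    (x : Site d) (w : List (Letter d)) :
    ‖((hol W' x w : 𝔸ˣ) : 𝔸) - ((hol W x w : 𝔸ˣ) : 𝔸)‖ ≤ w.length * ρ :=
  norm_hol_sub_hol_le hW hW' x w fun b _ => h b.1 b.2

end Words

/-! ## §2 Plaquette variables and the small-field radius (unitary matrices, operator norm (19)) -/

section Matrices

variable {d : ℕ} {n : Type*} [Fintype n] [DecidableEq n]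

/-- **Plaquette variables move by at most `4ρ`** under a bond-wise modification of size `ρ` (the plaquette word has
four letters). [folklore] -/
theorem norm_fhol_sub_fhol_le [Nonempty n] {W W' : Site d → Fin d → (Matrix n n ℂ)ˣ} (hW : IsUnitaryCfg W)
    (hW' : IsUnitaryCfg W') {ρ : ℝ} (h : ∀ x κ, ‖((W' x κ : (Matrix n n ℂ)ˣ) : (Matrix n n ℂ)) - ((W x κ : (Matrix n n ℂ)ˣ) : (Matrix n n ℂ))‖ ≤ ρ) (p : T4AveragingDeficitWall.Plaq d) :
    ‖((fhol W' p : (Matrix n n ℂ)ˣ) : (Matrix n n ℂ)) - ((fhol W p : (Matrix n n ℂ)ˣ) : (Matrix n n ℂ))‖ ≤ 4 * ρ := by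
  have hU : ∀ x κ, W x κ ∈ U1 (Matrix n n ℂ) := fun x κ => mem_U1_of_unitary (hW x κ)
  have hU' : ∀ x κ, W' x κ ∈ U1 (Matrix n n ℂ) := fun x κ => mem_U1_of_unitary (hW' x κ)
  have := norm_hol_sub_hol_le_of_forall hU hU' h p.1 (plaqWord p.2.1.1 p.2.1.2)
  simpa [fhol, plaqWord] using this

/-- **The small-field radius moves by at most `4ρ`**: `SmallField W a → SmallField W′ (a + 4ρ)`. [folklore] -/
theorem smallField_perturb [Nonempty n] {W W' : Site d → Fin d → (Matrix n n ℂ)ˣ} (hW : IsUnitaryCfg W) (hW' : IsUnitaryCfg W')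
    {ρ a : ℝ} (h : ∀ x κ, ‖((W' x κ : (Matrix n n ℂ)ˣ) : (Matrix n n ℂ)) - ((W x κ : (Matrix n n ℂ)ˣ) : (Matrix n n ℂ))‖ ≤ ρ) (hS : SmallField W a) :
    SmallField W' (a + 4 * ρ) := by
  intro x κ κ' hκ
  have hU : ∀ x κ, W x κ ∈ U1 (Matrix n n ℂ) := fun x κ => mem_U1_of_unitary (hW x κ)
  have hU' : ∀ x κ, W' x κ ∈ U1 (Matrix n n ℂ) := fun x κ => mem_U1_of_unitary (hW' x κ)
  have h4 : ‖((hol W' x (plaqWord κ κ') : (Matrix n n ℂ)ˣ) : (Matrix n n ℂ)) - ((hol W x (plaqWord κ κ') : (Matrix n n ℂ)ˣ) : (Matrix n n ℂ))‖ ≤ 4 * ρ := by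
    have := norm_hol_sub_hol_le_of_forall hU hU' h x (plaqWord κ κ')
    simpa [plaqWord] using this
  calc ‖((hol W' x (plaqWord κ κ') : (Matrix n n ℂ)ˣ) : (Matrix n n ℂ)) - 1‖
      ≤ ‖((hol W' x (plaqWord κ κ') : (Matrix n n ℂ)ˣ) : (Matrix n n ℂ)) - ((hol W x (plaqWord κ κ') : (Matrix n n ℂ)ˣ) : (Matrix n n ℂ))‖
        + ‖((hol W x (plaqWord κ κ') : (Matrix n n ℂ)ˣ) : (Matrix n n ℂ)) - 1‖ := norm_sub_le_norm_sub_add_norm_sub _ _ _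
    _ ≤ 4 * ρ + a := add_le_add h4 (hS x κ κ' hκ)
    _ = a + 4 * ρ := add_comm _ _

/-- A small field has every indexed plaquette variable within its radius of `1`. [folklore] -/
theorem norm_fhol_sub_one_le_of_smallField {W : Site d → Fin d → (Matrix n n ℂ)ˣ} {a : ℝ} (hS : SmallField W a) (p : T4AveragingDeficitWall.Plaq d) :
    ‖((fhol W p : (Matrix n n ℂ)ˣ) : (Matrix n n ℂ)) - 1‖ ≤ a :=
  hS p.1 p.2.1.1 p.2.1.2 (ne_of_lt p.2.2)

/-! ## §3 The flux -/

/-- **The flux moves by at most `8ρ`**: `‖F′(p) − F(p)‖ ≤ 8ρ` whenever `‖W(∂p) − 1‖ ≤ a` and `a + 4ρ ≤ 1/2` (both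
plaquette variables then lie in the ball of radius `1/2` on which `log` is `2`-Lipschitz). [folklore] -/
theorem norm_flux_sub_flux_le [Nonempty n] {W W' : Site d → Fin d → (Matrix n n ℂ)ˣ} (hW : IsUnitaryCfg W) (hW' : IsUnitaryCfg W')
    {ρ a : ℝ} (hρ : 0 ≤ ρ) (h : ∀ x κ, ‖((W' x κ : (Matrix n n ℂ)ˣ) : (Matrix n n ℂ)) - ((W x κ : (Matrix n n ℂ)ˣ) : (Matrix n n ℂ))‖ ≤ ρ) (p : T4AveragingDeficitWall.Plaq d)
    (hp : ‖((fhol W p : (Matrix n n ℂ)ˣ) : (Matrix n n ℂ)) - 1‖ ≤ a) (har : a + 4 * ρ ≤ 1 / 2) :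
    ‖flux W' p - flux W p‖ ≤ 8 * ρ := by
  have h4 := norm_fhol_sub_fhol_le hW hW' h p
  have hp' : ‖((fhol W' p : (Matrix n n ℂ)ˣ) : (Matrix n n ℂ)) - 1‖ ≤ 1 / 2 :=
    calc _ ≤ ‖((fhol W' p : (Matrix n n ℂ)ˣ) : (Matrix n n ℂ)) - ((fhol W p : (Matrix n n ℂ)ˣ) : (Matrix n n ℂ))‖ + ‖((fhol W p : (Matrix n n ℂ)ˣ) : (Matrix n n ℂ)) - 1‖ :=
          norm_sub_le_norm_sub_add_norm_sub _ _ _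
      _ ≤ 4 * ρ + a := add_le_add h4 hp
      _ ≤ 1 / 2 := by linarith
  have hp1 : ‖((fhol W p : (Matrix n n ℂ)ˣ) : (Matrix n n ℂ)) - 1‖ ≤ 1 / 2 := hp.trans (by linarith)
  unfold flux
  calc ‖mlog ((fhol W' p : (Matrix n n ℂ)ˣ) : (Matrix n n ℂ)) - mlog ((fhol W p : (Matrix n n ℂ)ˣ) : (Matrix n n ℂ))‖
      ≤ (1 + (1 / 2 : ℝ) / (1 - 1 / 2)) * ‖((fhol W' p : (Matrix n n ℂ)ˣ) : (Matrix n n ℂ)) - ((fhol W p : (Matrix n n ℂ)ˣ) : (Matrix n n ℂ))‖ :=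
        norm_mlog_sub_mlog_le (by norm_num) hp' hp1
    _ ≤ (1 + (1 / 2 : ℝ) / (1 - 1 / 2)) * (4 * ρ) := by gcongr
    _ = 8 * ρ := by norm_num; ring

/-- The flux of a small field is small: `‖F(p)‖ ≤ 2a` for `a ≤ 1/2` (B7 (26): `|log W| ≤ 2|W − 1|`).
[cite: Balaban1985Averaging, (26) p.21] -/
theorem norm_flux_le_of_smallField {W : Site d → Fin d → (Matrix n n ℂ)ˣ} {a : ℝ} (hS : SmallField W a) (ha : a ≤ 1 / 2)
    (p : T4AveragingDeficitWall.Plaq d) : ‖flux W p‖ ≤ 2 * a := by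
  have hp := norm_fhol_sub_one_le_of_smallField hS p
  unfold flux
  exact (norm_mlog_le_two_mul (hp.trans ha)).trans (by linarith)

/-! ## §4 The covariant flux gradient -/

/-- `‖Ad_{a′} X − Ad_a X‖ ≤ 2‖a′ − a‖·‖X‖` for unitary units `a, a′`
(`a′Xa′⁻¹ − aXa⁻¹ = (a′ − a)Xa′⁻¹ + aX(a′⁻¹ − a⁻¹)`). [folklore] -/
theorem norm_Ad_sub_Ad_le [Nonempty n] {a a' : (Matrix n n ℂ)ˣ} (ha : a ∈ unitaryUnits (Matrix n n ℂ)) (ha' : a' ∈ unitaryUnits (Matrix n n ℂ)) (X : (Matrix n n ℂ)) :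
    ‖Ad a' X - Ad a X‖ ≤ 2 * ‖(a' : (Matrix n n ℂ)) - (a : (Matrix n n ℂ))‖ * ‖X‖ := by
  have hinv := norm_units_inv_sub_inv_le (mem_U1_of_unitary ha') (mem_U1_of_unitary ha)
  have hn1 : ‖((a'⁻¹ : (Matrix n n ℂ)ˣ) : (Matrix n n ℂ))‖ ≤ 1 := (mem_U1.mp (mem_U1_of_unitary ha')).2
  have hn2 : ‖(a : (Matrix n n ℂ))‖ ≤ 1 := (mem_U1.mp (mem_U1_of_unitary ha)).1
  have e1 : Ad a' X - Ad a X
      = ((a' : (Matrix n n ℂ)) - (a : (Matrix n n ℂ))) * X * ((a'⁻¹ : (Matrix n n ℂ)ˣ) : (Matrix n n ℂ)) + (a : (Matrix n n ℂ)) * X * (((a'⁻¹ : (Matrix n n ℂ)ˣ) : (Matrix n n ℂ)) - ((a⁻¹ : (Matrix n n ℂ)ˣ) : (Matrix n n ℂ))) := by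
    unfold Ad; noncomm_ring
  rw [e1]
  calc _ ≤ ‖((a' : (Matrix n n ℂ)) - (a : (Matrix n n ℂ))) * X * ((a'⁻¹ : (Matrix n n ℂ)ˣ) : (Matrix n n ℂ))‖ + ‖(a : (Matrix n n ℂ)) * X * (((a'⁻¹ : (Matrix n n ℂ)ˣ) : (Matrix n n ℂ)) - ((a⁻¹ : (Matrix n n ℂ)ˣ) : (Matrix n n ℂ)))‖ :=
        norm_add_le _ _
    _ ≤ ‖(a' : (Matrix n n ℂ)) - (a : (Matrix n n ℂ))‖ * ‖X‖ * ‖((a'⁻¹ : (Matrix n n ℂ)ˣ) : (Matrix n n ℂ))‖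
        + ‖(a : (Matrix n n ℂ))‖ * ‖X‖ * ‖((a'⁻¹ : (Matrix n n ℂ)ˣ) : (Matrix n n ℂ)) - ((a⁻¹ : (Matrix n n ℂ)ˣ) : (Matrix n n ℂ))‖ :=
        add_le_add ((norm_mul_le _ _).trans (mul_le_mul_of_nonneg_right (norm_mul_le _ _) (norm_nonneg _)))
          ((norm_mul_le _ _).trans (mul_le_mul_of_nonneg_right (norm_mul_le _ _) (norm_nonneg _)))
    _ ≤ ‖(a' : (Matrix n n ℂ)) - (a : (Matrix n n ℂ))‖ * ‖X‖ * 1 + 1 * ‖X‖ * ‖(a' : (Matrix n n ℂ)) - (a : (Matrix n n ℂ))‖ := by gcongr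
    _ = 2 * ‖(a' : (Matrix n n ℂ)) - (a : (Matrix n n ℂ))‖ * ‖X‖ := by ring

/-- **The covariant flux gradient moves by at most `(16 + 4a)ρ`**: for unitary `W, W′` with `‖W′(b) − W(b)‖ ≤ ρ` on all
bonds, `SmallField W a` and `a + 4ρ ≤ 1/2`,
`‖(∇_{W′}F′)(x,κ;π) − (∇_W F)(x,κ;π)‖ ≤ 8ρ + 2ρ·2a + 8ρ`. [folklore] -/
theorem norm_covGrad_flux_sub_le [Nonempty n] {W W' : Site d → Fin d → (Matrix n n ℂ)ˣ} (hW : IsUnitaryCfg W)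
    (hW' : IsUnitaryCfg W') {ρ a : ℝ} (hρ : 0 ≤ ρ)
    (h : ∀ x κ, ‖((W' x κ : (Matrix n n ℂ)ˣ) : (Matrix n n ℂ)) - ((W x κ : (Matrix n n ℂ)ˣ) : (Matrix n n ℂ))‖ ≤ ρ) (hS : SmallField W a)
    (har : a + 4 * ρ ≤ 1 / 2) (x : Site d) (κ : Fin d) (π : T4AveragingDeficitWall.Plane d) :
    ‖covGrad W' (flux W') x κ π - covGrad W (flux W) x κ π‖ ≤ (16 + 4 * a) * ρ := by
  have hF : ∀ p : T4AveragingDeficitWall.Plaq d, ‖flux W' p - flux W p‖ ≤ 8 * ρ := fun p =>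
    norm_flux_sub_flux_le hW hW' hρ h p (norm_fhol_sub_one_le_of_smallField hS p) har
  have hX : ‖flux W (x + e κ, π)‖ ≤ 2 * a := norm_flux_le_of_smallField hS (by linarith) _
  set X := flux W (x + e κ, π)
  set X' := flux W' (x + e κ, π)
  have e1 : covGrad W' (flux W') x κ π - covGrad W (flux W) x κ π
      = Ad (W' x κ) (X' - X) + (Ad (W' x κ) X - Ad (W x κ) X) - (flux W' (x, π) - flux W (x, π)) := by
    unfold covGrad; rw [Ad_sub]; abel
  rw [e1]
  have h1 : ‖Ad (W' x κ) (X' - X)‖ ≤ 8 * ρ := by rw [norm_Ad_of_unitary (hW' x κ)]; exact hF _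
  have h2 : ‖Ad (W' x κ) X - Ad (W x κ) X‖ ≤ 2 * ρ * (2 * a) :=
    (norm_Ad_sub_Ad_le (hW x κ) (hW' x κ) X).trans (by gcongr; exact h x κ)
  have h3 : ‖flux W' (x, π) - flux W (x, π)‖ ≤ 8 * ρ := hF _
  calc _ ≤ ‖Ad (W' x κ) (X' - X) + (Ad (W' x κ) X - Ad (W x κ) X)‖ + ‖flux W' (x, π) - flux W (x, π)‖ :=
        norm_sub_le _ _
    _ ≤ (‖Ad (W' x κ) (X' - X)‖ + ‖Ad (W' x κ) X - Ad (W x κ) X‖) + ‖flux W' (x, π) - flux W (x, π)‖ :=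
        add_le_add (norm_add_le _ _) le_rfl
    _ ≤ (8 * ρ + 2 * ρ * (2 * a)) + 8 * ρ := add_le_add (add_le_add h1 h2) h3
    _ = (16 + 4 * a) * ρ := by ring

/-- **A pointwise flux-gradient bound `g` becomes `g + 18ρ`** (using `a ≤ 1/2`). [folklore] -/
theorem covGrad_flux_perturb [Nonempty n] {W W' : Site d → Fin d → (Matrix n n ℂ)ˣ} (hW : IsUnitaryCfg W) (hW' : IsUnitaryCfg W')
    {ρ a g : ℝ} (hρ : 0 ≤ ρ) (h : ∀ x κ, ‖((W' x κ : (Matrix n n ℂ)ˣ) : (Matrix n n ℂ)) - ((W x κ : (Matrix n n ℂ)ˣ) : (Matrix n n ℂ))‖ ≤ ρ) (hS : SmallField W a)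
    (har : a + 4 * ρ ≤ 1 / 2) (hg : ∀ (x : Site d) (κ : Fin d) (π : T4AveragingDeficitWall.Plane d), ‖covGrad W (flux W) x κ π‖ ≤ g)
    (x : Site d) (κ : Fin d) (π : T4AveragingDeficitWall.Plane d) : ‖covGrad W' (flux W') x κ π‖ ≤ g + 18 * ρ := by
  have hd := norm_covGrad_flux_sub_le hW hW' hρ h hS har x κ π
  have ha2 : (16 + 4 * a) * ρ ≤ 18 * ρ := mul_le_mul_of_nonneg_right (by linarith) hρ
  calc ‖covGrad W' (flux W') x κ π‖
      ≤ ‖covGrad W' (flux W') x κ π - covGrad W (flux W) x κ π‖ + ‖covGrad W (flux W) x κ π‖ :=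
        norm_le_norm_sub_add _ _
    _ ≤ 18 * ρ + g := add_le_add (hd.trans ha2) (hg x κ π)
    _ = g + 18 * ρ := add_comm _ _

/-! ## §5 Right multiplication by unitaries -/

/-- `W·u` is unitary-valued if `W` and `u` are. [folklore] -/
theorem isUnitaryCfg_mul {W u : Site d → Fin d → (Matrix n n ℂ)ˣ} (hW : IsUnitaryCfg W) (hu : IsUnitaryCfg u) :
    IsUnitaryCfg (fun x μ => W x μ * u x μ) :=
  fun x μ => (unitaryUnits (Matrix n n ℂ)).mul_mem (hW x μ) (hu x μ)

/-- `W·u` is `P`-periodic if `W` and `u` are. [folklore] -/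
theorem isPeriodicCfg_mul {W u : Site d → Fin d → (Matrix n n ℂ)ˣ} {P : ℤ} (hW : IsPeriodicCfg W P) (hu : IsPeriodicCfg u P) :
    IsPeriodicCfg (fun x μ => W x μ * u x μ) P := by
  intro x κ μ
  simp only [hW x κ μ, hu x κ μ]

/-- `‖W u − W‖ ≤ ‖u − 1‖` for unitary `W` (in fact equality). [folklore] -/
theorem norm_mul_sub_self_le [Nonempty n] {W u : Site d → Fin d → (Matrix n n ℂ)ˣ} (hW : IsUnitaryCfg W) (x : Site d) (μ : Fin d) :
    ‖((W x μ * u x μ : (Matrix n n ℂ)ˣ) : (Matrix n n ℂ)) - ((W x μ : (Matrix n n ℂ)ˣ) : (Matrix n n ℂ))‖ ≤ ‖((u x μ : (Matrix n n ℂ)ˣ) : (Matrix n n ℂ)) - 1‖ := by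
  have e1 : ((W x μ * u x μ : (Matrix n n ℂ)ˣ) : (Matrix n n ℂ)) - ((W x μ : (Matrix n n ℂ)ˣ) : (Matrix n n ℂ)) = ((W x μ : (Matrix n n ℂ)ˣ) : (Matrix n n ℂ)) * (((u x μ : (Matrix n n ℂ)ˣ) : (Matrix n n ℂ)) - 1) := by
    rw [Units.val_mul, mul_sub, mul_one]
  rw [e1]
  calc _ ≤ ‖((W x μ : (Matrix n n ℂ)ˣ) : (Matrix n n ℂ))‖ * ‖((u x μ : (Matrix n n ℂ)ˣ) : (Matrix n n ℂ)) - 1‖ := norm_mul_le _ _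
    _ ≤ 1 * ‖((u x μ : (Matrix n n ℂ)ˣ) : (Matrix n n ℂ)) - 1‖ := by gcongr; exact (mem_U1.mp (mem_U1_of_unitary (hW x μ))).1
    _ = _ := one_mul _

/-- The bond-wise hypothesis of §§2–4 for `W′ = W·u` from `‖u − 1‖ ≤ ρ`. [folklore] -/
theorem norm_mul_sub_self_le_of_forall [Nonempty n] {W u : Site d → Fin d → (Matrix n n ℂ)ˣ} (hW : IsUnitaryCfg W) {ρ : ℝ}
    (hu : ∀ x μ, ‖((u x μ : (Matrix n n ℂ)ˣ) : (Matrix n n ℂ)) - 1‖ ≤ ρ) (x : Site d) (μ : Fin d) :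
    ‖(((fun x μ => W x μ * u x μ) x μ : (Matrix n n ℂ)ˣ) : (Matrix n n ℂ)) - ((W x μ : (Matrix n n ℂ)ˣ) : (Matrix n n ℂ))‖ ≤ ρ :=
  (norm_mul_sub_self_le hW x μ).trans (hu x μ)

/-! ## §6 The level reading: data `(b₁ η′², c₁ η′³)` at `η′ = L^{−(j+1)}` and `ρ ≤ m η³`, `η = L^{−j}` -/

/-- Arithmetic of the scales: `m/(L^j)³ = m·L³/(L^{j+1})³`. [folklore] -/
theorem div_pow_level (L : ℕ) (hL : 1 ≤ L) (m : ℝ) (j : ℕ) :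
    m / ((L : ℝ) ^ j) ^ 3 = m * (L : ℝ) ^ 3 / ((L : ℝ) ^ (j + 1)) ^ 3 := by
  have hL0 : (0 : ℝ) < L := by exact_mod_cast hL
  rw [pow_succ]
  field_simp
  ring

/-- Arithmetic of the scales: `m·L³/(L^{j+1})³ ≤ m·L³/(L^{j+1})²` for `m ≥ 0`, `L ≥ 1`. [folklore] -/
theorem div_pow_three_le_div_pow_two (L : ℕ) (hL : 1 ≤ L) {m : ℝ} (hm : 0 ≤ m) (j : ℕ) :
    m * (L : ℝ) ^ 3 / ((L : ℝ) ^ (j + 1)) ^ 3 ≤ m * (L : ℝ) ^ 3 / ((L : ℝ) ^ (j + 1)) ^ 2 := by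
  have hL1 : (1 : ℝ) ≤ L := by exact_mod_cast hL
  have hP1 : (1 : ℝ) ≤ (L : ℝ) ^ (j + 1) := one_le_pow₀ hL1
  have hP0 : (0 : ℝ) < (L : ℝ) ^ (j + 1) := by positivity
  refine div_le_div_of_nonneg_left (by positivity) (by positivity) ?_
  calc ((L : ℝ) ^ (j + 1)) ^ 2 = ((L : ℝ) ^ (j + 1)) ^ 2 * 1 := (mul_one _).symm
    _ ≤ ((L : ℝ) ^ (j + 1)) ^ 2 * (L : ℝ) ^ (j + 1) := by gcongr
    _ = ((L : ℝ) ^ (j + 1)) ^ 3 := by ring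

/-- **Small-field radius at level `j+1` under a mismatch-sized modification**: `SmallField W (b₁/(L^{j+1})²)` and
`‖W′(b) − W(b)‖ ≤ m/(L^j)³` give `SmallField W′ ((b₁ + 4mL³)/(L^{j+1})²)` (the `b′ = b₁ + 2K m L³` of §3 R0 with the
chain-end constant `K` absorbed in `m`). [folklore] -/
theorem smallField_level_perturb [Nonempty n] {W W' : Site d → Fin d → (Matrix n n ℂ)ˣ} (hW : IsUnitaryCfg W)
    (hW' : IsUnitaryCfg W') (L : ℕ) (hL : 1 ≤ L) (j : ℕ) {b₁ m : ℝ} (hm : 0 ≤ m)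
    (h : ∀ x κ, ‖((W' x κ : (Matrix n n ℂ)ˣ) : (Matrix n n ℂ)) - ((W x κ : (Matrix n n ℂ)ˣ) : (Matrix n n ℂ))‖ ≤ m / ((L : ℝ) ^ j) ^ 3)
    (hS : SmallField W (b₁ / ((L : ℝ) ^ (j + 1)) ^ 2)) :
    SmallField W' ((b₁ + 4 * m * (L : ℝ) ^ 3) / ((L : ℝ) ^ (j + 1)) ^ 2) := by
  have h1 := smallField_perturb hW hW' h hS
  intro x κ κ' hκ
  have h2 : 4 * (m / ((L : ℝ) ^ j) ^ 3) ≤ 4 * (m * (L : ℝ) ^ 3 / ((L : ℝ) ^ (j + 1)) ^ 2) := by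
    rw [div_pow_level L hL m j]
    exact mul_le_mul_of_nonneg_left (div_pow_three_le_div_pow_two L hL hm j) (by norm_num)
  calc ‖((hol W' x (plaqWord κ κ') : (Matrix n n ℂ)ˣ) : (Matrix n n ℂ)) - 1‖
      ≤ b₁ / ((L : ℝ) ^ (j + 1)) ^ 2 + 4 * (m / ((L : ℝ) ^ j) ^ 3) := h1 x κ κ' hκ
    _ ≤ b₁ / ((L : ℝ) ^ (j + 1)) ^ 2 + 4 * (m * (L : ℝ) ^ 3 / ((L : ℝ) ^ (j + 1)) ^ 2) := add_le_add le_rfl h2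
    _ = (b₁ + 4 * m * (L : ℝ) ^ 3) / ((L : ℝ) ^ (j + 1)) ^ 2 := by ring

/-- **Pointwise flux gradient at level `j+1` under a mismatch-sized modification**: with `SmallField W (b₁/(L^{j+1})²)`,
`‖W′(b) − W(b)‖ ≤ m/(L^j)³`, the side condition `b₁/(L^{j+1})² + 4m/(L^j)³ ≤ 1/2`, and
`‖(∇_W F)‖ ≤ c₁/(L^{j+1})³` everywhere, the modified field has `‖(∇_{W′}F′)‖ ≤ (c₁ + 18mL³)/(L^{j+1})³` everywhere
(the `c′ = c₁ + K′ m L³` of §3 R0). [folklore] -/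
theorem covGrad_flux_level_perturb [Nonempty n] {W W' : Site d → Fin d → (Matrix n n ℂ)ˣ} (hW : IsUnitaryCfg W)
    (hW' : IsUnitaryCfg W') (L : ℕ) (hL : 1 ≤ L) (j : ℕ) {b₁ c₁ m : ℝ} (hm : 0 ≤ m)
    (h : ∀ x κ, ‖((W' x κ : (Matrix n n ℂ)ˣ) : (Matrix n n ℂ)) - ((W x κ : (Matrix n n ℂ)ˣ) : (Matrix n n ℂ))‖ ≤ m / ((L : ℝ) ^ j) ^ 3)
    (hS : SmallField W (b₁ / ((L : ℝ) ^ (j + 1)) ^ 2))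
    (har : b₁ / ((L : ℝ) ^ (j + 1)) ^ 2 + 4 * (m / ((L : ℝ) ^ j) ^ 3) ≤ 1 / 2)
    (hg : ∀ (x : Site d) (κ : Fin d) (π : T4AveragingDeficitWall.Plane d), ‖covGrad W (flux W) x κ π‖ ≤ c₁ / ((L : ℝ) ^ (j + 1)) ^ 3)
    (x : Site d) (κ : Fin d) (π : T4AveragingDeficitWall.Plane d) :
    ‖covGrad W' (flux W') x κ π‖ ≤ (c₁ + 18 * m * (L : ℝ) ^ 3) / ((L : ℝ) ^ (j + 1)) ^ 3 := by
  have hρ : 0 ≤ m / ((L : ℝ) ^ j) ^ 3 := by positivity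
  have h1 := covGrad_flux_perturb hW hW' hρ h hS har hg x κ π
  rw [div_pow_level L hL m j] at h1
  refine h1.trans (le_of_eq ?_)
  ring

end Matrices

end

end Summit.QuantumFields.BalabanUV.T4Continuum.GaugeFieldPerturbation
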